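import Mathlib
import Literature.Computability.Complexity.ExtMonotoneGates
import Literature.Computability.Complexity.ExtMonotoneGRankSupport
import Literature.Computability.Complexity.CliqueApproximatorsWide
import Literature.Computability.Complexity.RossmanMonotoneCliqueProb
import Summits.PneNP.PneNP.Theses.ConvexRankGates
import Summits.PneNP.PneNP.Theorems.ConvexRankGatesLinAlgGateBlindDefs
import Summits.PneNP.PneNP.Theorems.ConvexRankGatesLinAlgGateBlindTermCollapse
import Summits.PneNP.PneNP.Theorems.ConvexRankGatesLinAlgGateBlindPluckingBound
import Summits.PneNP.PneNP.Theorems.ConvexRankGatesLinAlgGateBlindWideApproxHost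
import Summits.PneNP.PneNP.Theorems.ConvexRankGatesLinAlgGateBlindDenseRegime
-- (not imported, not needed by the composition: Summits.PneNP.PneNP.Theorems.ConvexRankGatesLinAlgGateBlindSGPermLocality —
--  sg_of_locality / sgAt_of_partition / sgAt_of_plantedFamily; …Planting — sg_of_maxtermCover; …PermSmallDim — sgAt_perm_of_fewSubgroups)
import Summits.PneNP.PneNP.Theorems.ConvexRankGatesLinAlgGateBlindSGGRankCalibration
import Summits.PneNP.PneNP.Theorems.LinAlgGateBlind.Negative.DetGate
import Summits.PneNP.PneNP.Theorems.LinAlgGateBlind.Negative.CliquePolyDetRepr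
import Summits.PneNP.PneNP.Theorems.LinAlgGateBlind.Negative.OnePermGate

/-!
# Skeleton line `dnf-invariant-wide-gates-see-small-cliques` for crux `LinAlgGateBlind` (stmt-PneNP-10681) — rev 3 (lead c1, 2026-08-16)

rev 3 (continuation lead c1): `LinAlgGateBlind_of` now takes ONLY the two open stubs as hypotheses and discharges the four landed
ones internally (skeleton check OK); line verdict `Lines/dnf-invariant-wide-gates-see-small-cliques-dead.md` (dead at `stub_sgGRank`:
the crux as typed ⇒ Valiant's hypothesis, `Theorems/ConvexRankGatesLinAlgGateBlindCliqueVNP.lean` + `…ValiantHypothesis.lean`).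

STATUS (lead prover-line-stmt-PneNP-10681-0, after wave 1): the line vocabulary and FOUR of the six registered stubs
are LANDED in the tree and imported here — `Theorems/ConvexRankGatesLinAlgGateBlindDefs.lean` (p77236; kOf/lOf/rOf/qOf/
epsOf, atomB/acceptsB, IsTermGate, lostPos/gainedNeg, SGAt, GateApprox), `…TermCollapse.lean` (p80791, `stub_termCollapse`),
`…PluckingBound.lean` (p80095, `stub_pluckingBound`), `…WideApproxHost.lean` (p78695, `stub_wideApproxHost`),
`…DenseRegime.lean` + `…DenseRegimeAux.lean` (p82561/p79305, `stub_denseRegime`); plus `…SGPermLocality.lean` (p80930: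
`sg_of_locality`, `sgAt_of_partition`, `sgAt_of_plantedFamily`, PERM maxterm cover `isTermGate_perm_eq_false_iff`) and
`…SGGRankCalibration.lean` (p78741: `sgAt_gRank_dc_lowerBound`). The composition `LinAlgGateBlind_of` below is unchanged and
now rests on exactly TWO sorries: `stub_sgPerm` (research; NonabelianPermDoorBlind-type single-gate bound) and `stub_sgGRank`
(Valiant-hard: §8 proves `stub_sgGRank → dc_F(CL_{m,⌈m^{1/8}⌉}) > m^c` eventually, for every field `F`).
-/

/-!
# Skeleton line `dnf-invariant-wide-gates-see-small-cliques` for crux `LinAlgGateBlind` (stmt-PneNP-10681)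

Route `PneNP/ConvexRankGates`; crux decl `Summit.PneNP.PneNP.Theses.ConvexRankGates.LinAlgGateBlind`
(`∃ δ ∈ (0,1/2), ∀ c, ∀ᶠ m, no circuit with ≤ m^c gates over {∧₂,∨₂} ∪ PERM_{m^c} ∪ GRANK_{m^c} computes
CLIQUE(m, ⌈m^δ⌉₊)`); idea card `Cruxes/LinAlgGateBlind/Ideas/dnf-invariant-wide-gates-see-small-cliques.md`
(ideator 2; triage r1: pass ×3 with the MANDATORY sharpening "errors one-sided", honoured below).

THE LINE. Run the Alon–Boppana approximation method in the lattice `K(m, r, l)` of closed families of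
`≤ l`-vertex sets (tree: `Razborov.IsClosedFamily`, `Razborov.closure`) on the referee pair POSITIVES = bare
`k`-cliques `cliqueVec S` (`k = kOf m = ⌈m^{1/8}⌉₊`, counted), NEGATIVES = `G(m, q)` (`q = qOf m =
1 - 4 ln m / k`, the tree's product measure `prob q`), and push the invariant "every wire carries a
small-clique DNF `⌈F⌉ = ⋁_{X ∈ F} ⌈X⌉`" THROUGH each wide gate: a PERM/GRANK gate fed by small-clique DNFs
is literally ONE gate of the same class and the same size parameter over clique ATOMS `⌈X⌉`, `X ∈ 𝒱(l)` — a
TERM GATE (`IsTermGate`; `stub_termCollapse`: PERM∘OR ⊆ PERM by repeating generator wires, GRANK∘OR ⊆ GRANK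
at equal dimension since `Xᵢ ↦ Σ_a X'_{i,a}` preserves generic rank). Each term gate is replaced by the
closure of whatever small-clique DNF approximates it with ONE-SIDED errors `ε = epsOf c m = m^{-(c+1)}/4`
(lost `k`-cliques `lostPos`, gained `G(m,q)`-mass `gainedNeg`) — the single-gate statement `SGAt`, filed per
class as the two research stubs `stub_sgPerm`, `stub_sgGRank`. The ∧/∨ steps and the re-closure are the
classical lattice operations: `∧ ↦ A ∩ B` loses `≤ ((r-1)^l)² C(m-l-1, k-l-1)` cliques (tree, PROVED:
`card_errPos_le_wide`), `∨ ↦ (A ∪ B)*` and re-closure gain `≤ |𝒱(l)| (1 - q^{C(l,2)})^r` of `G(m,q)`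
(`stub_pluckingBound`, the `G(m,q)` twin of the tree's `card_errNeg_mul_le`). The host `stub_wideApproxHost`
is the generic straight-line induction over `{∧₂,∨₂} ∪ W` for ANY set `W` of monotone wide gates with a
per-gate interface `GateApprox`, plus the endgame (empty output family ⇒ every `k`-set lost; nonempty ⇒ it
accepts `≥ q^{C(l,2)}` of `G(m,q)`, which is `k`-clique-free up to `1/4`). `stub_denseRegime` is the
Alon–Boppana parameter calculus at `δ = 1/8` (`l = ⌊√(k/(4 log₂ m + 1))⌋`, `r = (l+c+2)(⌊log₂ m⌋+1)+2`):
`q^{C(l,2)} ≥ 1/2`, plucking and trimming budgets `≤ ε`, `m^c ε ≤ 1/16`, `Pr[G(m,q) ⊇ K_k] ≤ 1/4`.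
`LinAlgGateBlind_of` composes the six stubs into the crux BY NAME (`δ := 1/8`, `W := Lin (m^c)`, `t := m^c`,
`εP := ε`, `εN := 2ε`), a real proof; `LinAlgGateBlind_closed` feeds it the stubs.

DISPROOF USED (`Cruxes/LinAlgGateBlind/Disproof.lean` gen 2, all PROVED there; the three landed Negative
files are imported here and co-elaborate): read-back `linAlgGateBlind_iff` (re-proved below by `Iff.rfl`,
same `Lin`/`basis`); (a) `not_withoutSizeBound` — the size bound is used exactly once, as `t = m^c` in the
host's two union bounds `t·εP < 1`, `t·εN + Pr[clique] < q^{C(l,2)}`; `not_withoutBasis` — the host asks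
`GateApprox` only of gates of `W = Lin (m^c)` and monotonicity of every gate (a `¬` gate has no one-sided
approximator); `not_withoutPermDim` / `not_withoutGRankDim` / `not_blindDim_pow_kOf` /
`not_blindPermOnly_pow_kOf` — the SG stubs are asked only of term gates of parameter `≤ m^c`: at parameter
`m^{k+3}` ONE gate computes CLIQUE (`Negative.exists_onePermGate_computes_cliqueFn`,
`exists_oneGRankGate_computes_cliqueFn`) and for that term gate `O = CLIQUE` every small-clique DNF has
`lostPos = all` or `gainedNeg ≥ q^{C(l,2)} - Pr[clique] ≥ 1/4`, so SG is FALSE there — the stubs genuinely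
spend `d ≤ m^c`; `not_blindConstK` / `blind_window` — `δ = 1/8 > 0` fixed, `k → ∞` drives
`Pr[G(m,q) ⊇ K_k] → 0` in `stub_denseRegime`; `not_uniformThreshold` — every stub is `∀ c, ∀ᶠ m`.
(b) headline `dc_cliquePoly_superpolynomial_of_linAlgGateBlind`: inherited by `stub_sgGRank` ALONE (its
`O` ranges over affine symbolic pencils of dimension `m^c` with wild constants; a proof of it for the term
gates `CL_{m,k'}∘atoms` is a support-robust determinantal lower bound) — recorded as the hardest stub, the
PERM stub does not touch it. (d) `Sketch3Copy.not_shadowCliqueCover` concerns another card; no stub here has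
that shape. No stub is an instance of a landed Negative lemma (those are one-gate CONSTRUCTIONS at dimension
`2 + C(m,k)(#E - 1)` resp. `1 + C(m,k)#E`, far above `m^c`).

Conventions: `sorry` appears ONLY inside the six `stub_*` theorems; every other declaration is proved.
-/

set_option linter.unusedVariables false
set_option linter.unusedSectionVars false
set_option linter.dupNamespace false

namespace Summit.PneNP.PneNP.Cruxes.LinAlgGateBlind.DnfInvariantWideGatesSeeSmallCliques

open scoped BigOperators
open Finset Filter Literature.Computability.Complexity Razborov

noncomputable section

/-! ### §0 The crux read back with named pieces -/

/-- `Lin s = PERM_s ∪ GRANK_s`, the wide gates of the crux (the route's inline `let Lin`; texts of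
`IsPermGate`/`IsGRankGate` are literally those disjuncts). [folklore] -/
def Lin (s : ℕ) : Set GateFn := {g | IsPermGate s g ∨ IsGRankGate s g}

/-- The basis of the crux: `{∧₂, ∨₂} ∪ Lin s` (`= monotoneBasis ∪ Lin s` by `rfl`). [folklore] -/
def basis (s : ℕ) : Set GateFn := {GateFn.and 2, GateFn.or 2} ∪ Lin s

/-- The inner statement of the crux at exponent `δ` (clique size `⌈m^δ⌉₊`). [folklore] -/
def BlindAt (δ : ℝ) : Prop :=
  ∀ c : ℕ, ∀ᶠ m : ℕ in atTop, ∀ C : Circuit (KEdge m),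
    C.IsOver (basis (m ^ c)) → C.size ≤ m ^ c → ¬ C.Computes (cliqueFn m ⌈(m : ℝ) ^ δ⌉₊)

/-- **Read-back** (as in `Disproof.linAlgGateBlind_iff`): the crux IS `∃ δ ∈ (0,1/2), BlindAt δ`, by `Iff.rfl`
(the inline clique function is `cliqueFn`, the inline gate classes are `IsPermGate`/`IsGRankGate`). -/
theorem linAlgGateBlind_iff :
    Summit.PneNP.PneNP.Theses.ConvexRankGates.LinAlgGateBlind ↔
      ∃ δ : ℝ, 0 < δ ∧ δ < 1 / 2 ∧ BlindAt δ := Iff.rfl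

/-- `basis s = {∧₂, ∨₂} ∪ Lin s` with the tree's name for the monotone basis. -/
theorem basis_eq (s : ℕ) : basis s = monotoneBasis ∪ Lin s := rfl

/-- Every `Lin` gate computes a monotone Boolean function (tree: `IsPermGate.monotone`,
`IsGRankGate.monotone`). -/
theorem lin_monotone {s : ℕ} {g : GateFn} (hg : g ∈ Lin s) : Monotone g.2 := by
  rcases hg with hg | hg
  · exact hg.monotone
  · exact hg.monotone

/-! ### §3 Proved sanity lemmas kept in the skeleton (the monotonicity / locality lemmas `atomB_mono`,
`isTermGate_monotone`, `cliqueVec_le_of_cliquePresent`, `sg_of_locality` now live in the landed module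
`Theorems/ConvexRankGatesLinAlgGateBlindSGPermLocality.lean`, same names, imported above) -/

/-- Enlarging the approximating family can only shrink the set of lost positives. -/
theorem lostPos_anti {m k : ℕ} (O : (KEdge m → Bool) → Bool) {𝒜 ℬ : Finset (Finset (Fin m))}
    (h : 𝒜 ⊆ ℬ) : lostPos m k O ℬ ⊆ lostPos m k O 𝒜 := by
  intro S hS
  simp only [lostPos, mem_filter] at hS ⊢
  exact ⟨hS.1, hS.2.1, fun hacc => hS.2.2 (hacc.mono h)⟩

/-- Replacing `𝒜` by a family `ℬ` gains at most the `G(m,q)`-mass of `[⌈ℬ⌉ ∧ ¬⌈𝒜⌉]` (union bound; used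
with `ℬ = 𝒜*`, whose extra mass is the plucking error). -/
theorem gainedNeg_le_add {m : ℕ} {q : ℝ} (hq0 : 0 ≤ q) (hq1 : q ≤ 1) (O : (KEdge m → Bool) → Bool)
    (𝒜 ℬ : Finset (Finset (Fin m))) :
    gainedNeg m q O ℬ ≤ gainedNeg m q O 𝒜 +
      prob q (fun x : KEdge m → Bool => Accepts ℬ x ∧ ¬ Accepts 𝒜 x) := by
  unfold gainedNeg
  calc prob q (fun x : KEdge m → Bool => O x = false ∧ Accepts ℬ x)
      ≤ prob q (fun x : KEdge m → Bool =>
          (O x = false ∧ Accepts 𝒜 x) ∨ (Accepts ℬ x ∧ ¬ Accepts 𝒜 x)) :=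
        prob_mono hq0 hq1 fun x hx => by
          by_cases h𝒜 : Accepts 𝒜 x
          · exact Or.inl ⟨hx.1, h𝒜⟩
          · exact Or.inr ⟨hx.2, h𝒜⟩
    _ ≤ _ := prob_or_le hq0 hq1 _ _

/-! ### §4 The six stub STATEMENTS (named `Prop`s; the registered `stub_*` theorems restate them verbatim and
`Registered.stub_*` are the name-keyed aliases used as the hypotheses of `LinAlgGateBlind_of`) -/

/-- Statement of STUB 1 — TERM-GATE COLLAPSE (`Lin ∘ OR ⊆ Lin`, class by class, same size parameter): a PERM
(resp. GRANK) gate of parameter `s` fed with the small-clique DNFs `⌈A_i⌉`, `A_i ⊆ 𝒱(l)`, is ONE PERM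
(resp. GRANK) gate of parameter `s` over the atoms `⌈X⌉`, `X ∈ ⋃ A_i`. [folklore] -/
def TermCollapse : Prop :=
  ∀ (m s l : ℕ) (g : GateFn) (A : Fin g.1 → Finset (Finset (Fin m))),
    (∀ i, A i ⊆ smallSets (Fin m) l) →
      (IsPermGate s g → IsTermGate m (IsPermGate s) l fun x => g.2 fun i => acceptsB (A i) x) ∧
      (IsGRankGate s g → IsTermGate m (IsGRankGate s) l fun x => g.2 fun i => acceptsB (A i) x)

/-- Statement of STUB 2 — PLUCKING UNDER `G(m,q)`: closing a family `𝒞 ⊆ 𝒱(l)` in `K(m, r, l)` wrongly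
accepts a `q`-random graph with probability `≤ |𝒱(l)|·(1 - q^{C(l,2)})^r` (the `G(m,q)` twin of the tree's
`card_errNeg_mul_le` for colourings, Alon–Boppana 1987 Lemma 3.7). [folklore] -/
def PluckingBound : Prop :=
  ∀ (m r l : ℕ) (q : ℝ), 0 ≤ q → q ≤ 1 → ∀ 𝒞 : Finset (Finset (Fin m)), 𝒞 ⊆ smallSets (Fin m) l →
    prob q (fun x : KEdge m → Bool => Accepts (closure r l 𝒞) x ∧ ¬ Accepts 𝒞 x)
      ≤ (#(smallSets (Fin m) l) : ℝ) * (1 - q ^ (l.choose 2)) ^ r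

/-- Statement of STUB 3 — THE HOST (approximation method with wide gates, finite form): for a set `W` of
MONOTONE gate functions, if `∨` (closure of a union of closed families) gains `≤ εN`, `∧` (intersection)
loses `≤ εP·C(m,k)` `k`-cliques, and every `W`-gate over closed children has a closed one-sided
`(εP, εN)`-approximator (`GateApprox`), then no circuit over `{∧₂,∨₂} ∪ W` with `≤ t` gates computes
`CLIQUE(m,k)` as soon as `t·εP < 1` and `t·εN + Pr[G(m,q) ⊇ K_k] < q^{C(l,2)}`. [folklore] -/
def WideApproxHost : Prop :=
  ∀ (m k r l t : ℕ) (q εP εN : ℝ) (W : Set GateFn),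
    2 ≤ r → 2 ≤ l → k ≤ m → 0 ≤ q → q ≤ 1 → 0 ≤ εP → 0 ≤ εN →
    (∀ g ∈ W, Monotone g.2) →
    (∀ A B : Finset (Finset (Fin m)), IsClosedFamily r l A → IsClosedFamily r l B →
      prob q (fun x : KEdge m → Bool => Accepts (closure r l (A ∪ B)) x ∧ ¬ Accepts (A ∪ B) x) ≤ εN) →
    (∀ A B : Finset (Finset (Fin m)), IsClosedFamily r l A → IsClosedFamily r l B →
      (#(errPos k A B) : ℝ) ≤ εP * (m.choose k : ℝ)) →
    (∀ g ∈ W, GateApprox m k r l q εP εN g) →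
    (t : ℝ) * εP < 1 →
    (t : ℝ) * εN + prob q (fun x : KEdge m → Bool => cliqueFn m k x = true) < q ^ (l.choose 2) →
    ∀ C : Circuit (KEdge m), C.IsOver (monotoneBasis ∪ W) → C.size ≤ t →
      ¬ C.Computes (cliqueFn m k)

/-- Statement of STUB 4 — THE DENSE REGIME AT `δ = 1/8` (Alon–Boppana parameter calculus): eventually in
`m`, the lattice parameters are legal, `q ∈ [0,1]`, the plucking budget `|𝒱(l)|(1-q^{C(l,2)})^r` and the
trimming budget `((r-1)^l)² C(m-l-1, k-l-1)` are `≤ ε` resp. `≤ ε C(m,k)`, `m^c ε ≤ 1/16`, `G(m,q)` has a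
`k`-clique with probability `≤ 1/4`, and an atom is present with probability `q^{C(l,2)} ≥ 1/2`. [folklore] -/
def DenseRegime : Prop :=
  ∀ c : ℕ, ∀ᶠ m : ℕ in atTop,
    2 ≤ lOf m ∧ 2 ≤ rOf c m ∧ kOf m ≤ m ∧ 0 ≤ qOf m ∧ qOf m ≤ 1 ∧
    (#(smallSets (Fin m) (lOf m)) : ℝ) * (1 - qOf m ^ ((lOf m).choose 2)) ^ rOf c m ≤ epsOf c m ∧
    ((((rOf c m - 1) ^ lOf m) ^ 2 * (m - (lOf m + 1)).choose (kOf m - (lOf m + 1)) : ℕ) : ℝ)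
        ≤ epsOf c m * (m.choose (kOf m) : ℝ) ∧
    ((m ^ c : ℕ) : ℝ) * epsOf c m ≤ 1 / 16 ∧
    prob (qOf m) (fun x : KEdge m → Bool => cliqueFn m (kOf m) x = true) ≤ 1 / 4 ∧
    (1 / 2 : ℝ) ≤ qOf m ^ ((lOf m).choose 2)

/-- Statement of STUB 5 — SG FOR PERM TERM GATES (research): at `δ = 1/8`, for every `c`, eventually every
permutation-group-membership gate on `≤ m^c` points over `≤ lOf m`-atoms is one-sidedly `epsOf c m`-close
on (bare `kOf m`-cliques) × `G(m, qOf m)` to some small-clique DNF. [folklore] -/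
def SGPerm : Prop :=
  ∀ c : ℕ, ∀ᶠ m : ℕ in atTop, SGAt m (IsPermGate (m ^ c)) (lOf m) (kOf m) (qOf m) (epsOf c m)

/-- Statement of STUB 6 — SG FOR GRANK TERM GATES (research; Valiant-hard by the Disproof headline): the same
for generic-rank threshold gates of dimension `≤ m^c` over any field. [folklore] -/
def SGGRank : Prop :=
  ∀ c : ℕ, ∀ᶠ m : ℕ in atTop, SGAt m (IsGRankGate (m ^ c)) (lOf m) (kOf m) (qOf m) (epsOf c m)

/-! ### §5 The registered stubs still OPEN (`sorry` lives ONLY here). LANDED (imported above, same names + signatures,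
`--supports stmt-PneNP-10681`): `stub_termCollapse` (p80791, …TermCollapse.lean), `stub_pluckingBound` (p80095,
…PluckingBound.lean), `stub_wideApproxHost` (p78695, …WideApproxHost.lean), `stub_denseRegime` (p82561 + Aux p79305,
…DenseRegime{,Aux}.lean). -/

/-- **Stub 5 — SG for PERM term gates (research; the PERM half of the crux in single-gate, one-sided,
distributional form).** For a permutation-group-membership gate `O(x) = [τ ∈ ⟨σ_a : ⌈X_a⌉(x)⟩]` on `≤ m^c`
points over atoms `X_a ∈ 𝒱(l)`: EITHER `O` rejects `≤ ε` of `G(m,q)` (take `𝒜 = {∅}`), OR all but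
`ε C(m,k)` of the bare `k`-cliques `K_S` it accepts are accepted through a small sub-clique (`sg_of_locality`:
`𝒜* = {X ∈ 𝒱(l) : O(K_X) = 1}`, zero negative error), OR a genuinely mixed DNF exists. Abelian `σ_a` =
monotone span programs over `ℤ/q'` whose rows are labelled by `≤ l`-cliques — Gál's rank-measure
characterisation and Pitassi–Robere lifting apply with atoms in place of variables and a free choice of
rectangle (accepted cliques × rejected graphs); nonabelian `σ_a` through the companion card
`invariant-module-linearisation` (ANDs of span tests double the atom size `l ↦ 2l`). Why it might be false:
a PERM gate of dimension `m^c` detecting mid-range cliques (`≥ 0.44k` vertices) on the pair would refute it —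
for PERM that would be a distributional poly-size membership test for CLIQUE-like structure (no P/poly
contradiction, but none is known; the Disproof's one-gate CLIQUE needs `2 + C(m,k)(#E-1)` points,
`Negative.exists_onePermGate_computes_cliqueFn`). Counting cannot prove it beyond `d ≤ m^{2-δ}` (ideator BN2). -/
theorem stub_sgPerm :
    ∀ c : ℕ, ∀ᶠ m : ℕ in atTop, SGAt m (IsPermGate (m ^ c)) (lOf m) (kOf m) (qOf m) (epsOf c m) := by
  sorry

/-- **Stub 6 — SG for GRANK term gates (research; the HARDEST stub, calibrated Valiant-hard).** For a
generic-rank threshold gate `O(x) = [θ ≤ rank (K₀ + Σ_{⌈X_a⌉(x)} X_a K_a)]`, `d ≤ m^c`, any field, over atoms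
`X_a ∈ 𝒱(l)`: the same one-sided dichotomy. By `IsGRankGate.eq_true_iff_exists_support` the acceptance set is
the up-closure of the monomial supports of the `θ`-minors, so this says: a poly-dimension affine pencil whose
minors' supports (read through atoms) touch `> ε` of the bare `k`-cliques only non-locally must have a
non-vanishing `θ`-minor on all but `ε` of `G(m,q)`. It contains the support-robust determinantal lower bound
of the Disproof headline (`dc_cliquePoly_superpolynomial_of_linAlgGateBlind`: term gates `CL_{m,k'} ∘ atoms`,
`k' ∈ (0.44k, k]`, wild constants) — `≥ VNP ⊄ VBP`-strength in every characteristic; algebraic natural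
proofs / rank-method barriers (tree `RankMethodBarriers`, EGOW2018) bite on any rank-flattening proof. The
cancellation-free sub-case (generic entries on zero patterns = transversal-matroid / König gates) is the
reachable layer (cards `konig-atoms-cancellation-split` ≈ `theta-budget-flat-certificates`, counting range
`d ≤ m^{2-δ}/polylog`); the planner-level repair pointer is re-typing GRANK to read-≤2 pencils (`IsReadK`). -/
theorem stub_sgGRank :
    ∀ c : ℕ, ∀ᶠ m : ℕ in atTop, SGAt m (IsGRankGate (m ^ c)) (lOf m) (kOf m) (qOf m) (epsOf c m) := by
  sorry

/-! ### §6 Name-keyed aliases of the six statements (the hypotheses of the composition) -/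
namespace Registered

/-- Alias of `TermCollapse` keyed by the registered stub name. -/
abbrev stub_termCollapse : Prop := TermCollapse
/-- Alias of `PluckingBound` keyed by the registered stub name. -/
abbrev stub_pluckingBound : Prop := PluckingBound
/-- Alias of `WideApproxHost` keyed by the registered stub name. -/
abbrev stub_wideApproxHost : Prop := WideApproxHost
/-- Alias of `DenseRegime` keyed by the registered stub name. -/
abbrev stub_denseRegime : Prop := DenseRegime
/-- Alias of `SGPerm` keyed by the registered stub name. -/
abbrev stub_sgPerm : Prop := SGPerm
/-- Alias of `SGGRank` keyed by the registered stub name. -/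
abbrev stub_sgGRank : Prop := SGGRank

end Registered

/-! ### §7 The kernel-checked composition -/

/-- **Composition.** The six stubs imply the crux BY NAME. Take `δ = 1/8`; for each `c` intersect the
`∀ᶠ m` filters of the regime and of the two SG stubs; at such an `m` feed the host with `W := Lin (m^c)`,
`t := m^c`, `εP := ε`, `εN := 2ε`: the `∨`-hypothesis is plucking (Stub 2) within budget, the `∧`-hypothesis is
the tree's `card_errPos_le_wide` within budget, and a `Lin` gate over closed children collapses (Stub 1) to a
term gate of its own class, gets an SG-approximator `𝒜` (Stub 5/6), and `𝒜*` is the closed approximator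
(lost cliques can only decrease, `lostPos_anti`; gained mass grows by the plucking error, `gainedNeg_le_add` +
Stub 2); the two endgame budgets are `m^c ε ≤ 1/16` and `2/16 + 1/4 < 1/2 ≤ q^{C(l,2)}`. No `sorry`. -/
theorem LinAlgGateBlind_of (hPerm : Registered.stub_sgPerm) (hGRank : Registered.stub_sgGRank) :
    Summit.PneNP.PneNP.Theses.ConvexRankGates.LinAlgGateBlind := by
  -- the four LANDED obligations are discharged here by the imported proved theorems (rev 3, lead c1)
  have hColl : Registered.stub_termCollapse := stub_termCollapse
  have hPluck : Registered.stub_pluckingBound := stub_pluckingBound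
  have hHost : Registered.stub_wideApproxHost := stub_wideApproxHost
  have hReg : Registered.stub_denseRegime := stub_denseRegime
  rw [linAlgGateBlind_iff]
  refine ⟨1 / 8, by norm_num, by norm_num, fun c => ?_⟩
  filter_upwards [hReg c, hPerm c, hGRank c] with m hR hP hG C hC hsize
  obtain ⟨hl, hr, hkm, hq0, hq1, hpl, hand, heps, hclq, hhalf⟩ := hR
  have hε : 0 ≤ epsOf c m := epsOf_nonneg c m
  refine hHost m (kOf m) (rOf c m) (lOf m) (m ^ c) (qOf m) (epsOf c m) (2 * epsOf c m) (Lin (m ^ c))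
    hr hl hkm hq0 hq1 hε (mul_nonneg (by norm_num) hε) (fun g hg => lin_monotone hg)
    ?_ ?_ ?_ ?_ ?_ C hC hsize
  · -- (∨): plucking within budget
    intro A B hA hB
    calc prob (qOf m) (fun x : KEdge m → Bool =>
          Accepts (closure (rOf c m) (lOf m) (A ∪ B)) x ∧ ¬ Accepts (A ∪ B) x)
        ≤ (#(smallSets (Fin m) (lOf m)) : ℝ) * (1 - qOf m ^ ((lOf m).choose 2)) ^ rOf c m :=
          hPluck m (rOf c m) (lOf m) (qOf m) hq0 hq1 (A ∪ B) (union_subset hA.subset hB.subset)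
      _ ≤ epsOf c m := hpl
      _ ≤ 2 * epsOf c m := by linarith
  · -- (∧): Alon–Boppana trimming count (tree) within budget
    intro A B hA hB
    calc (#(errPos (kOf m) A B) : ℝ)
        ≤ ((((rOf c m - 1) ^ lOf m) ^ 2 * (m - (lOf m + 1)).choose (kOf m - (lOf m + 1)) : ℕ) : ℝ) := by
          exact_mod_cast card_errPos_le_wide hr hA hB
      _ ≤ epsOf c m * (m.choose (kOf m) : ℝ) := hand
  · -- wide gates: collapse to a term gate, SG, re-close
    intro g hg A hA
    have hsub : ∀ i, A i ⊆ smallSets (Fin m) (lOf m) := fun i => (hA i).subset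
    obtain ⟨𝒜, h𝒜, hlost, hgain⟩ : ∃ 𝒜 ⊆ smallSets (Fin m) (lOf m),
        (#(lostPos m (kOf m) (fun x => g.2 fun i => acceptsB (A i) x) 𝒜) : ℝ)
            ≤ epsOf c m * (m.choose (kOf m) : ℝ) ∧
          gainedNeg m (qOf m) (fun x => g.2 fun i => acceptsB (A i) x) 𝒜 ≤ epsOf c m := by
      rcases hg with hg | hg
      · exact hP _ ((hColl m (m ^ c) (lOf m) g A hsub).1 hg)
      · exact hG _ ((hColl m (m ^ c) (lOf m) g A hsub).2 hg)
    refine ⟨closure (rOf c m) (lOf m) 𝒜, isClosedFamily_closure _ _ _, ?_, ?_⟩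
    · calc (#(lostPos m (kOf m) (fun x => g.2 fun i => acceptsB (A i) x)
            (closure (rOf c m) (lOf m) 𝒜)) : ℝ)
          ≤ (#(lostPos m (kOf m) (fun x => g.2 fun i => acceptsB (A i) x) 𝒜) : ℝ) := by
            exact_mod_cast card_le_card (lostPos_anti _ (subset_closure h𝒜))
        _ ≤ epsOf c m * (m.choose (kOf m) : ℝ) := hlost
    · calc gainedNeg m (qOf m) (fun x => g.2 fun i => acceptsB (A i) x) (closure (rOf c m) (lOf m) 𝒜)
          ≤ gainedNeg m (qOf m) (fun x => g.2 fun i => acceptsB (A i) x) 𝒜 +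
              prob (qOf m) (fun x : KEdge m → Bool =>
                Accepts (closure (rOf c m) (lOf m) 𝒜) x ∧ ¬ Accepts 𝒜 x) :=
            gainedNeg_le_add hq0 hq1 _ _ _
        _ ≤ epsOf c m + (#(smallSets (Fin m) (lOf m)) : ℝ) * (1 - qOf m ^ ((lOf m).choose 2)) ^ rOf c m :=
            add_le_add hgain (hPluck m (rOf c m) (lOf m) (qOf m) hq0 hq1 𝒜 h𝒜)
        _ ≤ 2 * epsOf c m := by linarith
  · -- positive-side budget: `m^c ε ≤ 1/16 < 1`
    exact lt_of_le_of_lt heps (by norm_num)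
  · -- negative-side budget: `2 m^c ε + Pr[clique] ≤ 1/8 + 1/4 < 1/2 ≤ q^{C(l,2)}`
    have h2 : ((m ^ c : ℕ) : ℝ) * (2 * epsOf c m) = 2 * (((m ^ c : ℕ) : ℝ) * epsOf c m) := by ring
    rw [h2]
    linarith

/-- **`LinAlgGateBlind_closed`** — the same composition as a CLOSED term (the crux modulo the six `stub_*`
sorries): the registered stubs, stated verbatim, are definitionally the named statements and feed
`LinAlgGateBlind_of`. When all six stubs land, this theorem is the sorry-free proof to propose with
`--workitem stmt-PneNP-10681`. -/
theorem LinAlgGateBlind_closed : Summit.PneNP.PneNP.Theses.ConvexRankGates.LinAlgGateBlind :=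
  LinAlgGateBlind_of stub_sgPerm stub_sgGRank

/-! ### §8 Calibration of the open GRANK stub (lead): `stub_sgGRank` is at least Valiant-hard -/

/-- **`stub_sgGRank ⇒ dc_F(CL_{m,⌈m^{1/8}⌉}) > m^c` eventually in `m`, for every `c` and EVERY field `F`.**
The numerics of the landed `stub_denseRegime` (`2 ≤ l`, `k ≤ m`, `q ∈ [0,1]`, `m^c ε ≤ 1/16`, `Pr[clique] ≤ 1/4`,
`q^{C(l,2)} ≥ 1/2`) and `denseRegime_params` (`m^{1/16} ≥ c + 3`) discharge the explicit hypotheses of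
the landed certificate `sgAt_gRank_dc_lowerBound` (p78741): for `O = CLIQUE(m,k)` realised as ONE GRANK term gate by an
affine determinantal representation of `CL_{m,k}` of size `≤ m^c`, no small-clique DNF is a one-sided approximator.
So whoever proves `stub_sgGRank` proves that the clique polynomials `CL_{m,⌈m^{1/8}⌉}` have superpolynomial
determinantal complexity over every field — a `VNP ⊄ VBP`-strength statement (cf. the crux Disproof headline
`dc_cliquePoly_superpolynomial_of_linAlgGateBlind`, here localised to the single stub). -/
theorem sgGRank_forces_dc_lowerBound (hG : Registered.stub_sgGRank) (c : ℕ) (F : Type) [Field F] :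
    ∀ᶠ m : ℕ in atTop, ∀ d ≤ m ^ c,
      ¬ Literature.Computability.AlgebraicComplexity.HasDetRepr
        (Summit.PneNP.PneNP.Theorems.LinAlgGateBlind.Negative.cliquePoly m F (kOf m)) d := by
  filter_upwards [hG c, stub_denseRegime c, denseRegime_params c] with m hSG hR hP d hd
  obtain ⟨hl, -, hkm, hq0, hq1, -, -, heps, hclq, hhalf⟩ := hR
  obtain ⟨h4, -, hc3, -⟩ := hP
  have hx2 : (2 : ℝ) ≤ (m : ℝ) ^ (1 / 16 : ℝ) := by
    have hc0 : (0 : ℝ) ≤ (c : ℝ) := Nat.cast_nonneg c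
    linarith
  have hk2 : 2 ≤ kOf m := by
    have := DenseRegime.lOf_add_one_le_kOf hx2
    omega
  have hε : epsOf c m ≤ 1 / 16 := by
    have h1 : (1 : ℝ) ≤ ((m ^ c : ℕ) : ℝ) := by
      have : 1 ≤ m ^ c := Nat.one_le_pow _ _ (by omega)
      exact_mod_cast this
    exact (le_mul_of_one_le_left (epsOf_nonneg c m) h1).trans heps
  have hε1 : epsOf c m < 1 := by linarith
  have hbudget : prob (qOf m) (fun x : KEdge m → Bool => cliqueFn m (kOf m) x = true) + epsOf c m <
      qOf m ^ ((lOf m).choose 2) := by linarith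
  exact sgAt_gRank_dc_lowerBound m (lOf m) (kOf m) (m ^ c) d (qOf m) (epsOf c m) F hl hk2 hkm hq0 hq1 hε1
    hbudget hd hSG

end

end Summit.PneNP.PneNP.Cruxes.LinAlgGateBlind.DnfInvariantWideGatesSeeSmallCliques
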